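import Mathlib
import Literature.Computability.MetaComplexity.ACRearrangementTreeLike
import Summits.PneNP.PneNP.Theses.FregeLinesACUniverse

/-!
# BC5 rung for crux `ACRearrangementLowerBound` (route `FregeLinesACUniverse`, stmt-PneNP-19641)

Sibling-model witness (tribunal test T3): the crux asks for `∃ C, ∀ᶠ n, ∃ π, (n+1)·log₂(n+1) ≤ C · acUniverse π`
(DAG-LIKE universe measure, open).  In the TREE-LIKE LINE measure `ACRewriting.treeLines` the same
statement is DECIDED by counting (Sleator–Tarjan–Thurston 1992, Thm 4.1(2) shape), landed as the Literature
module `ACRearrangementTreeLike` (p541166).  Why it lies outside S's known regime and exercises the lever: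
no superlinear Frege LINE lower bound is known for any explicit tautology family (Krajíček 1995 p. 248), and
the rung is exactly the route's counting/rigidity lever run in the one model (tree-like) where counting
closes; for dag-like universes counting provably stops at Ω(N) (universes of size U number 2^Θ(U log U)),
which is the content left in the crux.  Nothing here bears on P versus NP.
-/

set_option linter.dupNamespace false

namespace Summit.PneNP.PneNP.Cruxes.ACRearrangementLowerBound.Birth

open Literature.Computability.MetaComplexity

/-- BC5 rung: the crux statement with `treeLines` (least number of lines of a tree-like AC derivation of
`combPerm 1 = combPerm π`) in place of `acUniverse`; `C = 72` works. -/
theorem ACRearrangementLowerBound_rung :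
    ∃ C : ℕ, ∀ᶠ n : ℕ in Filter.atTop, ∃ π : Equiv.Perm (Fin (n + 1)),
      (n + 1) * Nat.log 2 (n + 1) ≤ C * ACRewriting.treeLines π :=
  ACRewriting.exists_perm_treeLines_superlinear

/-- The non-asymptotic form: for every `n + 1 ≥ 4` some rearrangement needs `≥ (n+1)·log₂(n+1)/72`
tree-like lines. -/
theorem ACRearrangementLowerBound_rung_explicit (n : ℕ) (hn : 4 ≤ n + 1) :
    ∃ π : Equiv.Perm (Fin (n + 1)), (n + 1) * Nat.log 2 (n + 1) ≤ 72 * ACRewriting.treeLines π :=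
  ACRewriting.treeLines_lower_bound hn

/-- Sanity link to the crux's own objects: the crux is literally the `acUniverse` version of the rung. -/
example : Summit.PneNP.PneNP.Theses.FregeLinesACUniverse.ACRearrangementLowerBound ↔
    ∃ C : ℕ, ∀ᶠ n : ℕ in Filter.atTop, ∃ π : Equiv.Perm (Fin (n + 1)),
      (n + 1) * Nat.log 2 (n + 1) ≤ C * ACRewriting.acUniverse π :=
  Iff.rfl

end Summit.PneNP.PneNP.Cruxes.ACRearrangementLowerBound.Birth
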